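import Mathlib.Analysis.InnerProductSpace.Spectrum
import Literature.MathematicalPhysics.QuantumFieldTheory.Balaban1983to89.B1Prop21RegularTorusFam
import Literature.MathematicalPhysics.QuantumFieldTheory.Balaban1983to89.B1Eq230FluctCovPos

/-!
# `Balaban1983to89.B1Claim18RegularTorus` — [B4]'s IN-TEXT CLAIM (1.8) «−Δ^{η,N}_{A,Ω} + aP_k(A) ≥ γ₀I» FOR THE (Higgs)₂,₃ CARRIER
# ON Ω = T_ε AT EVERY (2.23)-REGULAR VECTOR FIELD `A`, AND [B4] §1 TYPED (`Claim18Printed ∧ ThmPrintedNN`) ON THE MEMBERS OF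
# `regTorusFam` CARRYING THE CUBE COVER OF [B4] §2

statement-level skeleton of published theorems with citation tags; proofs where landed; nothing here is a claim about the Yang–Mills mass gap

CITATION HEADER (lean-in-tree rule).  T. Bałaban, *Regularity and decay of lattice Green's functions*, Commun. Math. Phys. **89** (1983)
571–597 [Balaban1983RegularityDecay] (p. 573 (1.8), Theorem (1.9)–(1.10) p. 573, §2 pp. 575–578) and T. Bałaban, *(Higgs)₂,₃ quantum fields in a
finite volume. I*, Commun. Math. Phys. **85** (1982) 603–626 [Balaban1982Higgs1] ((1.5) p. 604, (2.20) p. 610, Prop. 2.1 (2.23)–(2.25)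
pp. 610–611).  Cell `lit-balaban`, Phase-2 proof seat **p35** gen 11 (unit `lit-balaban-p35`); SKELETON rows **B4.Claim18** (decl of record
`B4.Claim18Printed`, owner r01) — its instance ON THE (Higgs)₂,₃ CARRIER AT A REGULAR FIELD `A ≠ 0` —, **B4.Thm@573**, **B1.Prop2.1**.
USED BY NAME, never restated: `B4.{EtaSetting, Claim18Printed}`, `B4Ineq111ZeroNestEta.ThmPrintedNN`, this seat's `B1Prop21RegularTorusFam.{RegTorusIdx,
regTorusFam, thmPrintedNN_regTorusFam, regTorusFam_nonvacuous}` (p322075), `B1Ineq225RegularTorus.abs_acT_sub_le_of_reg` (p321120),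
`B1TorusCubeBoxOp.cube_inputs` (gen 8), `B1TorusCubeLocality26.norm_propagatorK_univ_le` (gen 8), `B1Ineq225BackgroundTorus.three_half_le_sites`,
`HiggsCovariancePos.{siteInner_covOpK_ge, propagatorK_covOpK_apply, siteInner_self_nonneg}`, `B1Eq230FluctCovPos.siteInner_covOpK_comm`,
`HiggsFluctMeasurePos.{siteInner_comm, siteInner_add_right, siteInner_smul_right}`; Mathlib's spectral theorem
`LinearMap.IsSymmetric.eigenvectorBasis`.

WHAT IS PRINTED ([B4] p. 573, verbatim).  *«The operator defining the Green's function (1.6) has a strictly positive lower bound. More exactly we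
prove that there exists a positive constant γ₀ such that for e sufficiently small and for a regular vector field A  −Δ^{η,N}_{A,Ω} + aP_k(A) ≥ γ₀I. (1.8)
The constant γ₀ is independent of the lattice spacing η, as well as of Ω and of A. This bound justifies the definition (1.6) and explains exponential
decay properties.»*  Standing hypotheses of p. 572: «We consider subsets Ω which are unions of big blocks» of size `M`, «M is a large positive integer
defined later in this paper»; the torus case «operators on subsets of a torus T_η which we identify with a rectangular parallelepiped».  NO PROOF OF
(1.8) IS PRINTED in [Balaban1983RegularityDecay] (the Theorem's proof, p. 579, bounds `G_k`; Lemma 2.1's proof (2.23)–(2.26) expands about a constant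
configuration inside one cube).

PROOF ROUTE OF THIS FILE (ours, labelled; elementary linear algebra on top of the kernel-checked (1.10)).  On `Ω = T_ε` the operator of (2.20)
`H_{m²} = −Δ^{ε,N}_A + m² + a_K(L^Kε)^{−2}P_K(A)` is symmetric for the scalar product (1.5) (`siteInner_covOpK_comm`) and `≥ m²`; for `m² > 0` its
inverse `G^ε_K(T_ε, A)` obeys the sup-norm bound of (1.10)/(2.25) `‖G^ε_Kg‖_∞ ≤ c₀(L^Kε)²‖g‖_∞` at every (2.23)-regular `A`, with `c₀` INDEPENDENT OF
`m² ∈ (0, 1]` (§2: the cube inputs of gen 8 are uniform on the mass window `m²(L^Kε)² ≤ ε₀²`).  Hence every eigenvalue `λ` of `H_{m²}` (eigenvector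
`v ≠ 0`, `v = λG^ε_Kv`) satisfies `‖v‖_∞ ≤ λc₀(L^Kε)²‖v‖_∞`, i.e. `λ ≥ (c₀(L^Kε)²)^{−1}`; by the spectral theorem for the symmetric `H_{m²}`
(§1, Mathlib's orthonormal eigenbasis after transport to `ℓ²`) `⟨φ, H_{m²}φ⟩ ≥ (c₀(L^Kε)²)^{−1}⟨φ, φ⟩`, and `m² → 0⁺` gives
`(L^Kε)²⟨φ, (−Δ^{ε,N}_A + a_K(L^Kε)^{−2}P_K(A))φ⟩ ≥ c₀^{−1}⟨φ, φ⟩` — (1.8) with `γ₀ = 1/c₀` in the carrier's `ε`-lattice units (the factor `(L^Kε)²`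
is the rescaling (2.22) to the `η`-lattice).

WHAT THIS FILE PROVES (kernel-checked, zero `sorry`; theorems + definitions with bodies; no `def … : Prop` fact).
* §1 `inner_eq_siteInner` (the `ℓ²` scalar product of the transported fields is `ε^{−d}·(1.5)`), `toL2`/`ofLp_toL2` (transport of an operator),
  **`siteInner_self_le_of_inverse_bound`** — for a `siteInner`-symmetric, positive semi-definite `H` with a left inverse `G`, `‖Gg‖_∞ ≤ c‖g‖_∞`
  implies `⟨φ, φ⟩ ≤ c⟨φ, Hφ⟩`.
* §2 **`norm_propagatorK_reg_le_unif`** — the (1.10)/(2.25) sup bound at every (2.23)-regular `A` with ONE constant for all `0 < m² ≤ 1`.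
* §3 **`lower18_reg_torus`** — (1.8) for the carrier: `∃ γ₀ > 0, K₀min, e₁(K₀) > 0`, for `K₀ ≥ K₀min`, every torus with `P.d = d`, `P.L = L ≥ 2`,
  `K₀ ∣ M`, every `1 ≤ K ≤ K_P` with `3·L^KK₀ ≤ |T_ε|_μ`, `L^Kε ≤ ε₀`, EVERY `A` and `0 < e_K ≤ e₁(K₀)` with (2.23), every `φ`:
  `γ₀⟨φ, φ⟩ ≤ (L^Kε)²⟨φ, (−Δ^{ε,N}_A + a_K(L^Kε)^{−2}P_K(A))φ⟩`; `lower18_reg_torus_bigBlocks` (cube condition as «K₀ ∣ M, 3K₀ ≤ 2M»).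
* §4 `RegTorusIdxB`/`regTorusFamB` (the members of `regTorusFam` with `bigBlocks`, i.e. the tori on which [B4] §2's cube cover fits),
  **`claim18Printed_regTorusFamB`** (`B4.Claim18Printed`), `thmPrintedNN_regTorusFamB` (restriction of p322075), **`section1_typed_regTorusFamB`**
  (`Claim18Printed ∧ ThmPrintedNN`, [B4] §1 typed, for the carrier at every regular `A`), `regTorusFamB_nonvacuous`.
HONEST SCOPE.  (i) (1.8) is proved for the members carrying the cube cover (`K₀ ∣ M`, `3K₀ ≤ 2M`, `K₀ ≥ K₀min`: the print's «unions of big blocks …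
M … large»); a torus whose side is not a multiple of the cube size is NOT covered by THIS file — v1.1: (1.8) at a (2.23)-regular `A` on EVERY
torus (every union of `k`-blocks, explicit `γ₀ = min{2, a(1 − L^{−2})/4}`, smallness `d²·c·e_k^β ≤ 1/3`) is r14's
`B1Ineq18RegularRegion.coercive_covOpK_of_reg223` (p322399, landed while this file was in review), packaged as `Claim18Printed (regTorusFam …)` on the
FULL family in the sibling `B1Claim18RegularTorusFam`; the present file remains the self-contained spectral route on the sub-family.  (ii) `γ₀ = 1/c₀`
with the `c₀` of (1.10) — the print's `γ₀` is not specified; the route (spectral bound from the sup bound) is ours, not the paper's.  (iii) `m² = 0` in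
(1.8) as printed; `a_K = B1.aSeq a L K` is the running coefficient of (2.15).  Unit `lit-balaban-p35` gen 11 (literature-prover-lit-balaban-p35-g11-0);
v1.1 (doc-only): HONEST SCOPE (i) cross-reference, declarations byte-identical.
-/

open scoped BigOperators InnerProductSpace

noncomputable section

namespace Literature.MathematicalPhysics.QuantumFieldTheory.Balaban1983to89.B1Claim18RegularTorus

open Literature.MathematicalPhysics.QuantumFieldTheory.Balaban1983to89.HiggsLattice (ChargeData ScalarField siteInner)
open Literature.MathematicalPhysics.QuantumFieldTheory.Balaban1983to89.HiggsCovariance (propagatorK covOpK)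
open Literature.MathematicalPhysics.QuantumFieldTheory.Balaban1983to89.HiggsCovariancePos (siteInner_covOpK_ge propagatorK_covOpK_apply
  siteInner_self_nonneg)
open Literature.MathematicalPhysics.QuantumFieldTheory.Balaban1983to89.HiggsFluctMeasurePos (siteInner_comm siteInner_add_right
  siteInner_smul_right)
open Literature.MathematicalPhysics.QuantumFieldTheory.Balaban1983to89.B1Eq230FluctCovPos (siteInner_covOpK_comm)
open Literature.MathematicalPhysics.QuantumFieldTheory.Balaban1983to89.B1TorusCubeCover (half Lab cube hTor)
open Literature.MathematicalPhysics.QuantumFieldTheory.Balaban1983to89.B1TorusCubeLocality26 (cubeVec norm_propagatorK_univ_le)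
open Literature.MathematicalPhysics.QuantumFieldTheory.Balaban1983to89.B1TorusCubeChart (dd)
open Literature.MathematicalPhysics.QuantumFieldTheory.Balaban1983to89.B1TorusCubeBoxOp (cube_inputs)
open Literature.MathematicalPhysics.QuantumFieldTheory.Balaban1983to89.B1Ineq225BackgroundTorus (three_half_le_sites)
open Literature.MathematicalPhysics.QuantumFieldTheory.Balaban1983to89.B1Ineq225RegularTorus (abs_acT_sub_le_of_reg)
open Literature.MathematicalPhysics.QuantumFieldTheory.Balaban1983to89.B1Prop21RegularTorusFam (RegTorusIdx regTorusFam
  thmPrintedNN_regTorusFam regTorusFam_nonvacuous)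
open Literature.MathematicalPhysics.QuantumFieldTheory.Balaban1983to89.B4 (EtaSetting Claim18Printed)
open Literature.MathematicalPhysics.QuantumFieldTheory.Balaban1983to89.B4Ineq111ZeroNestEta (ThmPrintedNN)

variable {P : HiggsLattice.Params} {N : ℕ}

/-! ## §1 The spectral lower bound from a sup-norm bound on the inverse -/

section Spectral

/-- The `ℓ²` model of the space of fields `T_ε → ℝ^N` (Mathlib's `PiLp 2`), used only to invoke the spectral theorem. [folklore] -/
abbrev L2 (P : HiggsLattice.Params) (N : ℕ) : Type := PiLp 2 (fun _ : HiggsLattice.Site P 0 => EuclideanSpace ℝ (Fin N))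

/-- The `ℓ²` scalar product of two transported fields is `ε^{−d}` times the scalar product (1.5). [cite: Balaban1982Higgs1, (1.5) p.604] -/
theorem inner_eq_siteInner (u v : L2 P N) :
    ⟪u, v⟫_ℝ = (P.mesh 0 ^ P.d)⁻¹ * siteInner (WithLp.ofLp u : ScalarField P 0 N) (WithLp.ofLp v) := by
  rw [PiLp.inner_apply]
  unfold siteInner
  rw [Finset.mul_sum]
  refine Finset.sum_congr rfl fun x _ => ?_
  rw [← mul_assoc, inv_mul_cancel₀ (pow_pos (P.mesh_pos 0) _).ne', one_mul]

/-- Transport of an operator on fields to the `ℓ²` model. [folklore] -/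
def toL2 (H : ScalarField P 0 N →ₗ[ℝ] ScalarField P 0 N) : L2 P N →ₗ[ℝ] L2 P N :=
  (WithLp.linearEquiv 2 ℝ (ScalarField P 0 N)).symm.toLinearMap ∘ₗ H ∘ₗ (WithLp.linearEquiv 2 ℝ (ScalarField P 0 N)).toLinearMap

/-- The transported operator acts as the operator on the underlying field. [folklore] -/
@[simp] private theorem ofLp_toL2 (H : ScalarField P 0 N →ₗ[ℝ] ScalarField P 0 N) (v : L2 P N) :
    WithLp.ofLp (toL2 H v) = H (WithLp.ofLp v) := rfl

/-- **THE SPECTRAL LOWER BOUND.**  Let `H` be an operator on the fields on `T_ε`, symmetric for the scalar product (1.5) and positive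
semi-definite, with a left inverse `G` bounded in the sup norm: `‖Gg‖_∞ ≤ c‖g‖_∞`.  Then `⟨φ, φ⟩ ≤ c⟨φ, Hφ⟩` for every `φ` (every eigenvalue
`λ` of `H` has an eigenvector `v = λGv`, so `1 ≤ λc`; then expand `φ` in an orthonormal eigenbasis).
[cite: Balaban1983RegularityDecay, (1.8) p.573, our route] -/
theorem siteInner_self_le_of_inverse_bound (H G : ScalarField P 0 N →ₗ[ℝ] ScalarField P 0 N)
    (hsymm : ∀ φ ψ : ScalarField P 0 N, siteInner φ (H ψ) = siteInner ψ (H φ))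
    (hpsd : ∀ φ : ScalarField P 0 N, 0 ≤ siteInner φ (H φ))
    (hinv : ∀ φ : ScalarField P 0 N, G (H φ) = φ) {c : ℝ}
    (hG : ∀ g : ScalarField P 0 N, ‖G g‖ ≤ c * ‖g‖) (φ : ScalarField P 0 N) :
    siteInner φ φ ≤ c * siteInner φ (H φ) := by
  classical
  have hw : 0 < P.mesh 0 ^ P.d := pow_pos (P.mesh_pos 0) _
  -- symmetry in the `ℓ²` model
  have hTs : (toL2 H).IsSymmetric := by
    intro u v
    rw [inner_eq_siteInner, inner_eq_siteInner, ofLp_toL2, ofLp_toL2, siteInner_comm (H (WithLp.ofLp u)), hsymm]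
  -- an orthonormal eigenbasis
  set n : ℕ := Module.finrank ℝ (L2 P N) with hn
  set b := hTs.eigenvectorBasis hn.symm with hb
  set ev : Fin n → ℝ := hTs.eigenvalues hn.symm with hev
  have happly : ∀ i, toL2 H (b i) = ev i • b i := fun i => hTs.apply_eigenvectorBasis hn.symm i
  -- every eigenvalue is at least `1/c`
  have hev_ge : ∀ i, 1 ≤ ev i * c := by
    intro i
    set f : ScalarField P 0 N := WithLp.ofLp (b i) with hf
    have hbi : b i ≠ 0 := b.orthonormal.ne_zero i
    have hf0 : f ≠ 0 := fun h => hbi ((WithLp.ofLp_eq_zero 2).1 h)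
    have hHf : H f = ev i • f := by
      have h := congrArg WithLp.ofLp (happly i)
      rw [ofLp_toL2, WithLp.ofLp_smul] at h
      exact h
    -- `f = ev i • G f`, so `‖f‖ ≤ |ev i|·c·‖f‖`
    have hfix : f = ev i • G f := by
      conv_lhs => rw [← hinv f, hHf, map_smul]
    have hnorm : ‖f‖ ≤ |ev i| * (c * ‖f‖) := by
      calc ‖f‖ = ‖ev i • G f‖ := by rw [← hfix]
        _ = |ev i| * ‖G f‖ := by rw [norm_smul, Real.norm_eq_abs]
        _ ≤ |ev i| * (c * ‖f‖) := mul_le_mul_of_nonneg_left (hG f) (abs_nonneg _)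
    have hfpos : 0 < ‖f‖ := norm_pos_iff.2 hf0
    have h1 : 1 ≤ |ev i| * c := by
      have : ‖f‖ * 1 ≤ ‖f‖ * (|ev i| * c) := by rw [mul_one]; linarith [hnorm]
      exact le_of_mul_le_mul_left this hfpos
    -- the eigenvalue is non-negative: `ev i = ⟨b i, H b i⟩ = ε^{−d}⟨f, Hf⟩ ≥ 0`
    have hev0 : 0 ≤ ev i := by
      have h2 : ⟪b i, toL2 H (b i)⟫_ℝ = ev i := by
        rw [happly i, real_inner_smul_right, real_inner_self_eq_norm_sq, b.orthonormal.1 i, one_pow, mul_one]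
      have h3 : ⟪b i, toL2 H (b i)⟫_ℝ = (P.mesh 0 ^ P.d)⁻¹ * siteInner f (H f) := by
        rw [inner_eq_siteInner, ofLp_toL2]
      rw [← h2, h3]
      exact mul_nonneg (inv_nonneg.2 hw.le) (hpsd f)
    rwa [abs_of_nonneg hev0] at h1
  -- expand `φ` in the eigenbasis
  set v : L2 P N := WithLp.toLp 2 φ with hv
  have hq : ⟪v, toL2 H v⟫_ℝ = ∑ i, ev i * (⟪b i, v⟫_ℝ * ⟪b i, v⟫_ℝ) := by
    rw [← b.sum_inner_mul_inner v (toL2 H v)]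
    refine Finset.sum_congr rfl fun i _ => ?_
    rw [← hTs (b i) v, happly i, real_inner_smul_left, real_inner_comm (b i) v]
    ring
  have hs : ⟪v, v⟫_ℝ = ∑ i, ⟪b i, v⟫_ℝ * ⟪b i, v⟫_ℝ := by
    rw [← b.sum_inner_mul_inner v v]
    exact Finset.sum_congr rfl fun i _ => by rw [real_inner_comm (b i) v]
  have hcmp : ⟪v, v⟫_ℝ ≤ c * ⟪v, toL2 H v⟫_ℝ := by
    rw [hq, hs, Finset.mul_sum]
    refine Finset.sum_le_sum fun i _ => ?_
    have hsq : 0 ≤ ⟪b i, v⟫_ℝ * ⟪b i, v⟫_ℝ := mul_self_nonneg _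
    calc ⟪b i, v⟫_ℝ * ⟪b i, v⟫_ℝ = 1 * (⟪b i, v⟫_ℝ * ⟪b i, v⟫_ℝ) := (one_mul _).symm
      _ ≤ (ev i * c) * (⟪b i, v⟫_ℝ * ⟪b i, v⟫_ℝ) := mul_le_mul_of_nonneg_right (hev_ge i) hsq
      _ = c * (ev i * (⟪b i, v⟫_ℝ * ⟪b i, v⟫_ℝ)) := by ring
  -- back to the scalar product (1.5)
  rw [inner_eq_siteInner, inner_eq_siteInner, ofLp_toL2] at hcmp
  have hφ : (WithLp.ofLp v : ScalarField P 0 N) = φ := rfl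
  rw [hφ] at hcmp
  rw [mul_left_comm] at hcmp
  exact le_of_mul_le_mul_left hcmp (inv_pos.2 hw)

end Spectral

/-! ## §2 The sup bound (1.10)/(2.25) at every (2.23)-regular field, uniformly in `0 < m² ≤ 1` -/

section SupBound

/-- **(1.10)/(2.25) VALUE MEMBER, SUP-NORM FORM, WITH ONE CONSTANT FOR ALL MASSES `0 < m² ≦ 1`.**  For `d`, `L ≧ 2`, `a > 0`, `N`, `(e, q)`, a mesh cap
`ε₀` and a regularity pair `c ≧ 0`, `β > 0`: constants `c₀ > 0`, `K₀min` and per cube size a threshold `e₁(K₀) > 0` such that for `K₀ ≧ K₀min`, on every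
torus of the carrier with `P.d = d`, `P.L = L`, `K₀ ∣ M`, at every level `1 ≦ K ≦ K_P` with `3·L^KK₀ ≦ |T_ε|_μ`, `L^Kε ≦ ε₀`, for EVERY vector field `A` and
`0 < e_K ≦ e₁(K₀)` with (2.23) in the form `(L^Kε|e|/e_K)|A_ν(x + εe_μ) − A_ν(x)| ≦ c·e_K^{β−1}/L^K`, EVERY mass `0 < m² ≦ 1` and every `g`:
`‖G^ε_K(T_ε, A; m²)g‖_∞ ≦ c₀(L^Kε)²‖g‖_∞`.  Proof = gen 8's walk `norm_propagatorK_univ_le` fed with `cube_inputs` on the mass window `m²(L^Kε)² ≦ ε₀²`.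
[cite: Balaban1982Higgs1, Prop. 2.1 (2.23), (2.25) p.610] [cite: Balaban1983RegularityDecay, Theorem (1.10) p.573; §2 pp.575–578] -/
theorem norm_propagatorK_reg_le_unif (d L : ℕ) (hL : 2 ≤ L) {a : ℝ} (ha : 0 < a) (N : ℕ) (C : ChargeData N) (ε₀ : ℝ)
    (creg β : ℝ) (hcreg : 0 ≤ creg) (hβ : 0 < β) :
    ∃ c₀ : ℝ, 0 < c₀ ∧ ∃ K₀min : ℕ, ∃ e₁ : ℕ → ℝ, (∀ K₀, 0 < e₁ K₀) ∧ ∀ K₀ : ℕ, K₀min ≤ K₀ →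
      ∀ (P : HiggsLattice.Params), P.d = d → P.L = L → K₀ ∣ P.M →
      ∀ {K : ℕ}, 1 ≤ K → K ≤ P.K → (∀ μ, 3 * half P K K₀ ≤ P.sitesPerDir 0 μ) → P.mesh K ≤ ε₀ →
      ∀ (A : HiggsLattice.VecField P 0) {ec : ℝ}, 0 < ec → ec ≤ e₁ K₀ →
      (∀ (x : HiggsLattice.Site P 0) (μ ν : Fin P.d),
          P.mesh K * |C.e| / ec * |A ⟨x.shift μ, ν⟩ - A ⟨x, ν⟩| ≤ creg * ec ^ (β - 1) / (P.L : ℝ) ^ K) →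
        ∀ {msq : ℝ}, 0 < msq → msq ≤ 1 → ∀ g : ScalarField P 0 N,
          ‖propagatorK C Finset.univ A msq a K g‖ ≤ c₀ * P.mesh K ^ 2 * ‖g‖ := by
  have hℓ0 : 1 ≤ L - 1 := by omega
  obtain ⟨Cγ, Cβ, hCγ, hCβ, hci⟩ := cube_inputs C (d - 1) (L - 1) hℓ0 a a (ε₀ ^ 2) ha
  have hci' : ∀ K₀ : ℕ, ∃ e₁ : ℝ, 0 < e₁ ∧ _ := fun K₀ => hci creg β hcreg hβ (max K₀ 8) (le_max_right _ _)
  choose e₁ he₁ hthr' using hci'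
  refine ⟨2 * 2 ^ d * Cγ, by positivity, max 8 (⌈(2 : ℝ) ^ (d + 1) * Cβ⌉₊), e₁, he₁, fun K₀ hK₀ => ?_⟩
  have hK₀8 : 8 ≤ K₀ := le_trans (le_max_left _ _) hK₀
  have hK₀C : (2 : ℝ) ^ (d + 1) * Cβ ≤ K₀ :=
    (Nat.le_ceil _).trans (by exact_mod_cast le_trans (le_max_right _ _) hK₀)
  have hmax : max K₀ 8 = K₀ := max_eq_left hK₀8
  have hthr := hthr' K₀
  rw [hmax] at hthr
  intro P hPd hPL hK₀M K hK1 hK hN3 hε A ec hec hle hreg msq hmsq hmsq1 g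
  subst hPd
  have hL2 : 2 ≤ P.L := by rw [hPL]; exact hL
  have hL1 : (1 : ℝ) < P.L := by exact_mod_cast hL2
  have hdd : dd P = P.d - 1 := rfl
  have hPL1 : P.L - 1 = L - 1 := by rw [hPL]
  have hmesh : 0 < P.mesh K := P.mesh_pos K
  have hcap : msq * P.mesh K ^ 2 ≤ ε₀ ^ 2 := by
    have h1 : P.mesh K ^ 2 ≤ ε₀ ^ 2 := pow_le_pow_left₀ hmesh.le hε 2
    calc msq * P.mesh K ^ 2 ≤ 1 * P.mesh K ^ 2 := mul_le_mul_of_nonneg_right hmsq1 (sq_nonneg _)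
      _ ≤ ε₀ ^ 2 := by rw [one_mul]; exact h1
  have hakP : 0 ≤ B1.aSeq a P.L K := (B1.aSeq_pos ha hL1 hK1).le
  have hcube := fun j : Lab P K K₀ =>
    hthr P hdd hPL1 K hK1 hK hK₀M hN3 a msq le_rfl le_rfl hmsq hcap j A ec hec hle (abs_acT_sub_le_of_reg C j A hec hreg)
  have hsmall : (2 : ℝ) ^ P.d * (Cβ / K₀) ≤ 1 / 2 := by
    have hK₀pos : (0 : ℝ) < K₀ := by exact_mod_cast (show 0 < K₀ by omega)
    rw [pow_succ] at hK₀C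
    rw [← mul_div_assoc, div_le_iff₀ hK₀pos]
    linarith
  have hmain := norm_propagatorK_univ_le C hK hK₀M hK₀8 hmsq a hakP A (γ := Cγ * P.mesh K ^ 2) (β := Cβ / K₀)
    (by positivity) (by positivity) (fun j ψ => (hcube j).1 ψ) (fun j ψ => (hcube j).2 ψ) hsmall g
  calc ‖propagatorK C Finset.univ A msq a K g‖ ≤ 2 * 2 ^ P.d * (Cγ * P.mesh K ^ 2) * ‖g‖ := hmain
    _ = 2 * 2 ^ P.d * Cγ * P.mesh K ^ 2 * ‖g‖ := by ring

end SupBound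

/-! ## §3 (1.8) for the carrier on `Ω = T_ε` at every (2.23)-regular field -/

section Lower

/-- the mass term of (2.20) split off: `⟨φ, H_{m²}φ⟩ = ⟨φ, H_0φ⟩ + m²⟨φ, φ⟩`. [cite: Balaban1982Higgs1, (2.20) p.610] -/
theorem siteInner_covOpK_mass (C : ChargeData N) (Ω : Finset (HiggsLattice.Site P 0)) (A : HiggsLattice.VecField P 0) (msq a : ℝ) (k : ℕ)
    (φ : ScalarField P 0 N) :
    siteInner φ (covOpK C Ω A msq a k φ) = siteInner φ (covOpK C Ω A 0 a k φ) + msq * siteInner φ φ := by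
  have h : covOpK C Ω A msq a k φ = covOpK C Ω A 0 a k φ + msq • φ := by
    simp only [covOpK, LinearMap.add_apply, LinearMap.smul_apply, LinearMap.id_apply, zero_smul, add_zero]
    abel
  rw [h, siteInner_add_right, siteInner_smul_right]

/-- `a ≦ b + t·s` for all `0 < t ≦ 1` (`s ≧ 0`) forces `a ≦ b` — the limit `m² → 0⁺`. [folklore] -/
private theorem le_of_forall_small_mass {a b s : ℝ} (hs : 0 ≤ s) (h : ∀ t : ℝ, 0 < t → t ≤ 1 → a ≤ b + t * s) : a ≤ b := by
  refine le_of_forall_pos_le_add fun ε hε => ?_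
  have ht : 0 < min 1 (ε / (s + 1)) := lt_min one_pos (div_pos hε (by linarith))
  refine (h _ ht (min_le_left _ _)).trans (add_le_add le_rfl ?_)
  calc min 1 (ε / (s + 1)) * s ≤ ε / (s + 1) * s := mul_le_mul_of_nonneg_right (min_le_right _ _) hs
    _ ≤ ε / (s + 1) * (s + 1) := mul_le_mul_of_nonneg_left (by linarith) (div_pos hε (by linarith)).le
    _ = ε := div_mul_cancel₀ _ (by linarith)

/-- **(1.8) FOR THE (Higgs)₂,₃ CARRIER ON `Ω = T_ε` AT EVERY (2.23)-REGULAR VECTOR FIELD** — «there exists a positive constant γ₀ such that for e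
sufficiently small and for a regular vector field A, −Δ^{η,N}_{A,Ω} + aP_k(A) ≧ γ₀I», here: `∃ γ₀ > 0, K₀min, e₁(K₀) > 0` such that for `K₀ ≧ K₀min`, on every
torus of the carrier with `P.d = d`, `P.L = L ≧ 2`, `K₀ ∣ M`, at every level `1 ≦ K ≦ K_P` with `3·L^KK₀ ≦ |T_ε|_μ`, `L^Kε ≦ ε₀`, for EVERY `A` and
`0 < e_K ≦ e₁(K₀)` with (2.23), and every `φ : T_ε → ℝ^N`:  `γ₀⟨φ, φ⟩ ≦ (L^Kε)²⟨φ, (−Δ^{ε,N}_A + a_K(L^Kε)^{−2}P_K(A))φ⟩` (scalar product (1.5); the factor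
`(L^Kε)²` is the rescaling (2.22)).  `γ₀ = 1/c₀` with the `c₀` of §2; route: §1 at each `0 < m² ≦ 1`, then `m² → 0⁺`.
[cite: Balaban1983RegularityDecay, (1.8) p.573] [cite: Balaban1982Higgs1, (2.20), (2.22), Prop. 2.1 (2.23) p.610] -/
theorem lower18_reg_torus (d L : ℕ) (hL : 2 ≤ L) {a : ℝ} (ha : 0 < a) (N : ℕ) (C : ChargeData N) (ε₀ : ℝ)
    (creg β : ℝ) (hcreg : 0 ≤ creg) (hβ : 0 < β) :
    ∃ γ₀ : ℝ, 0 < γ₀ ∧ ∃ K₀min : ℕ, ∃ e₁ : ℕ → ℝ, (∀ K₀, 0 < e₁ K₀) ∧ ∀ K₀ : ℕ, K₀min ≤ K₀ →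
      ∀ (P : HiggsLattice.Params), P.d = d → P.L = L → K₀ ∣ P.M →
      ∀ {K : ℕ}, 1 ≤ K → K ≤ P.K → (∀ μ, 3 * half P K K₀ ≤ P.sitesPerDir 0 μ) → P.mesh K ≤ ε₀ →
      ∀ (A : HiggsLattice.VecField P 0) {ec : ℝ}, 0 < ec → ec ≤ e₁ K₀ →
      (∀ (x : HiggsLattice.Site P 0) (μ ν : Fin P.d),
          P.mesh K * |C.e| / ec * |A ⟨x.shift μ, ν⟩ - A ⟨x, ν⟩| ≤ creg * ec ^ (β - 1) / (P.L : ℝ) ^ K) →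
        ∀ φ : ScalarField P 0 N,
          γ₀ * siteInner φ φ ≤ P.mesh K ^ 2 * siteInner φ (covOpK C Finset.univ A 0 a K φ) := by
  obtain ⟨c₀, hc₀, K₀min, e₁, he₁, H⟩ := norm_propagatorK_reg_le_unif d L hL ha N C ε₀ creg β hcreg hβ
  refine ⟨c₀⁻¹, inv_pos.2 hc₀, K₀min, e₁, he₁, fun K₀ hK₀ P hPd hPL hK₀M K hK1 hK hN3 hε A ec hec hle hreg φ => ?_⟩
  have hL1 : (1 : ℝ) < P.L := by
    have h2 : 2 ≤ P.L := by rw [hPL]; exact hL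
    exact_mod_cast h2
  have hakP : 0 ≤ B1.aSeq a P.L K := (B1.aSeq_pos ha hL1 hK1).le
  have hS : 0 ≤ siteInner φ φ := siteInner_self_nonneg φ
  -- at each mass `0 < m² ≦ 1`: `⟨φ, φ⟩ ≦ c₀(L^Kε)²(⟨φ, H_0φ⟩ + m²⟨φ, φ⟩)`
  have hmass : ∀ t : ℝ, 0 < t → t ≤ 1 →
      siteInner φ φ ≤ c₀ * P.mesh K ^ 2 * siteInner φ (covOpK C Finset.univ A 0 a K φ)
        + t * (c₀ * P.mesh K ^ 2 * siteInner φ φ) := by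
    intro t ht ht1
    have h := siteInner_self_le_of_inverse_bound (covOpK C Finset.univ A t a K) (propagatorK C Finset.univ A t a K)
      (fun φ' ψ => siteInner_covOpK_comm C Finset.univ A t a K φ' ψ)
      (fun φ' => (mul_nonneg ht.le (siteInner_self_nonneg φ')).trans (siteInner_covOpK_ge C Finset.univ A t a K hakP φ'))
      (fun φ' => propagatorK_covOpK_apply C Finset.univ A ht a K hakP φ')
      (fun g => H K₀ hK₀ P hPd hPL hK₀M hK1 hK hN3 hε A hec hle hreg ht ht1 g) φ
    rw [siteInner_covOpK_mass] at h
    linarith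
  have hlim := le_of_forall_small_mass (by positivity) hmass
  rw [inv_mul_le_iff₀ hc₀]
  calc siteInner φ φ ≤ c₀ * P.mesh K ^ 2 * siteInner φ (covOpK C Finset.univ A 0 a K φ) := hlim
    _ = c₀ * (P.mesh K ^ 2 * siteInner φ (covOpK C Finset.univ A 0 a K φ)) := by ring

/-- **(1.8) WITH THE CUBE CONDITION AS «`K₀ ∣ M`, `3K₀ ≦ 2M`»** (then `3·L^KK₀ ≦ |T_ε|_μ` at every level `K ≦ K_P`).
[cite: Balaban1983RegularityDecay, (1.8) p.573] [cite: Balaban1982Higgs1, (2.20), (2.23) p.610] -/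
theorem lower18_reg_torus_bigBlocks (d L : ℕ) (hL : 2 ≤ L) {a : ℝ} (ha : 0 < a) (N : ℕ) (C : ChargeData N) (ε₀ : ℝ)
    (creg β : ℝ) (hcreg : 0 ≤ creg) (hβ : 0 < β) :
    ∃ γ₀ : ℝ, 0 < γ₀ ∧ ∃ K₀min : ℕ, ∃ e₁ : ℕ → ℝ, (∀ K₀, 0 < e₁ K₀) ∧ ∀ K₀ : ℕ, K₀min ≤ K₀ →
      ∀ (P : HiggsLattice.Params), P.d = d → P.L = L → K₀ ∣ P.M → 3 * K₀ ≤ 2 * P.M →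
      ∀ {K : ℕ}, 1 ≤ K → K ≤ P.K → P.mesh K ≤ ε₀ →
      ∀ (A : HiggsLattice.VecField P 0) {ec : ℝ}, 0 < ec → ec ≤ e₁ K₀ →
      (∀ (x : HiggsLattice.Site P 0) (μ ν : Fin P.d),
          P.mesh K * |C.e| / ec * |A ⟨x.shift μ, ν⟩ - A ⟨x, ν⟩| ≤ creg * ec ^ (β - 1) / (P.L : ℝ) ^ K) →
        ∀ φ : ScalarField P 0 N,
          γ₀ * siteInner φ φ ≤ P.mesh K ^ 2 * siteInner φ (covOpK C Finset.univ A 0 a K φ) := by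
  obtain ⟨γ₀, hγ₀, K₀min, e₁, he₁, h⟩ := lower18_reg_torus d L hL ha N C ε₀ creg β hcreg hβ
  exact ⟨γ₀, hγ₀, K₀min, e₁, he₁, fun K₀ hK₀ P hPd hPL hK₀M h3M K hK1 hK hε A ec hec hle hreg φ =>
    h K₀ hK₀ P hPd hPL hK₀M hK1 hK (three_half_le_sites hK h3M) hε A hec hle hreg φ⟩

end Lower

/-! ## §4 [B4] §1 typed (`Claim18Printed ∧ ThmPrintedNN`) on the members of `regTorusFam` carrying the cube cover -/

section Family

variable {d L : ℕ} {ε₀ : ℝ} {K₀ : ℕ}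

/-- THE MEMBERS OF `regTorusFam` WITH `bigBlocks`: the tori of the carrier on which the cube cover of [B4] §2 fits (`K₀ ∣ M`, `3K₀ ≦ 2M`; p. 572 «We
consider subsets Ω which are unions of big blocks»). [cite: Balaban1983RegularityDecay, §1 p.572; §2 p.575] -/
def RegTorusIdxB (d L : ℕ) (ε₀ : ℝ) (K₀ : ℕ) : Type :=
  {i : RegTorusIdx d L ε₀ // K₀ ∣ i.P.M ∧ 3 * K₀ ≤ 2 * i.P.M}

/-- The family of settings on those members (the restriction of `regTorusFam`). [cite: Balaban1983RegularityDecay, §1 pp.572–573] -/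
def regTorusFamB (d L : ℕ) (C : ChargeData N) (a msq ε₀ creg β : ℝ) (K₀ : ℕ) : RegTorusIdxB d L ε₀ K₀ → EtaSetting :=
  fun i => regTorusFam d L C a msq ε₀ creg β K₀ i.1

/-- unfolding of the restricted family at a member. [cite: Balaban1983RegularityDecay, §1 pp.572–573] -/
theorem regTorusFamB_apply (C : ChargeData N) (a msq creg β : ℝ) (i : RegTorusIdxB d L ε₀ K₀) :
    regTorusFamB d L C a msq ε₀ creg β K₀ i = regTorusFam d L C a msq ε₀ creg β K₀ i.1 := rfl

/-- every member of the restricted family has `bigBlocks`. [cite: Balaban1983RegularityDecay, §1 p.572] -/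
theorem regTorusFamB_bigBlocks (C : ChargeData N) (a msq creg β : ℝ) (i : RegTorusIdxB d L ε₀ K₀) :
    (regTorusFamB d L C a msq ε₀ creg β K₀ i).bigBlocks := i.2

/-- **THE IN-TEXT CLAIM (1.8), TYPED (`B4.Claim18Printed`), FOR THE (Higgs)₂,₃ CARRIER AT EVERY (2.23)-REGULAR FIELD ON `Ω = T_ε`**: for `d`, `L ≧ 2`,
`a > 0`, any `m²` (not entering (1.8)), `N`, `(e,q)`, `ε₀`, `c ≧ 0`, `β > 0` there is `K₀min` such that for every `K₀ ≧ K₀min`,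
`Claim18Printed (regTorusFamB d L C a m² ε₀ c β K₀)` — «∃ γ₀, e₁ > 0, ∀ members, regular → 0 < e ≦ e₁ → −Δ^{η,N}_{A,Ω} + aP_k(A) ≧ γ₀I» with the witnesses
`γ₀ = 1/c₀`, `e₁ = e₁(K₀)` of §3. [cite: Balaban1983RegularityDecay, (1.8) p.573] -/
theorem claim18Printed_regTorusFamB (d L : ℕ) (hL : 2 ≤ L) {a : ℝ} (ha : 0 < a) (msq : ℝ) (C : ChargeData N) (ε₀ : ℝ)
    (creg β : ℝ) (hcreg : 0 ≤ creg) (hβ : 0 < β) :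
    ∃ K₀min : ℕ, ∀ K₀ : ℕ, K₀min ≤ K₀ → Claim18Printed (regTorusFamB d L C a msq ε₀ creg β K₀) := by
  obtain ⟨γ₀, hγ₀, K₀min, e₁, he₁, H⟩ := lower18_reg_torus_bigBlocks d L hL ha N C ε₀ creg β hcreg hβ
  refine ⟨K₀min, fun K₀ hK₀ => ⟨γ₀, e₁ K₀, hγ₀, he₁ K₀, fun i hreg hec hle => ?_⟩⟩
  obtain ⟨i, hK₀M, h3M⟩ := i
  dsimp only [regTorusFamB, regTorusFam] at hreg hec hle ⊢
  intro φ
  exact H K₀ hK₀ i.P i.hPd i.hPL hK₀M h3M i.hK1 i.hK i.hε i.A hec hle hreg φ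

/-- **THE THEOREM (ruled reading `ThmPrintedNN`) ON THE RESTRICTED FAMILY** — the restriction of `thmPrintedNN_regTorusFam` (p322075) to the members
with `bigBlocks`. [cite: Balaban1983RegularityDecay, Theorem (1.9)–(1.12) p.573] [cite: Balaban1982Higgs1, Prop. 2.1 (2.23)–(2.26) pp.610–611] -/
theorem thmPrintedNN_regTorusFamB (d L : ℕ) (hL : 2 ≤ L) {a : ℝ} (ha : 0 < a) {msq : ℝ} (hmsq : 0 < msq) (C : ChargeData N) (ε₀ : ℝ)
    (creg β : ℝ) (hcreg : 0 ≤ creg) (hβ : 0 < β) :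
    ∃ K₀min : ℕ, ∀ K₀ : ℕ, K₀min ≤ K₀ → ThmPrintedNN (regTorusFamB d L C a msq ε₀ creg β K₀) := by
  obtain ⟨K₀min, H⟩ := thmPrintedNN_regTorusFam (N := N) d L hL ha hmsq C ε₀ creg β hcreg hβ
  refine ⟨K₀min, fun K₀ hK₀ α hα0 hα1 => ?_⟩
  obtain ⟨δ₀, c₀, R₀, e₁, h1, h2, h3, h4, H'⟩ := H K₀ hK₀ α hα0 hα1
  exact ⟨δ₀, c₀, R₀, e₁, h1, h2, h3, h4, fun i => H' i.1⟩

/-- **[B4] §1 TYPED FOR THE (Higgs)₂,₃ CARRIER AT EVERY (2.23)-REGULAR FIELD ON `Ω = T_ε`**: the conjunction `Claim18Printed ∧ ThmPrintedNN` ((1.8) and the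
Theorem (1.9)–(1.12) in its ruled non-negative-Hölder reading) on `regTorusFamB`, for every `K₀ ≧ K₀min`.
[cite: Balaban1983RegularityDecay, (1.8) p.573, Theorem (1.9)–(1.12) p.573] -/
theorem section1_typed_regTorusFamB (d L : ℕ) (hL : 2 ≤ L) {a : ℝ} (ha : 0 < a) {msq : ℝ} (hmsq : 0 < msq) (C : ChargeData N) (ε₀ : ℝ)
    (creg β : ℝ) (hcreg : 0 ≤ creg) (hβ : 0 < β) :
    ∃ K₀min : ℕ, ∀ K₀ : ℕ, K₀min ≤ K₀ →
      Claim18Printed (regTorusFamB d L C a msq ε₀ creg β K₀) ∧ ThmPrintedNN (regTorusFamB d L C a msq ε₀ creg β K₀) := by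
  obtain ⟨K₁, H₁⟩ := claim18Printed_regTorusFamB (N := N) d L hL ha msq C ε₀ creg β hcreg hβ
  obtain ⟨K₂, H₂⟩ := thmPrintedNN_regTorusFamB (N := N) d L hL ha hmsq C ε₀ creg β hcreg hβ
  exact ⟨max K₁ K₂, fun K₀ hK₀ => ⟨H₁ K₀ (le_trans (le_max_left _ _) hK₀), H₂ K₀ (le_trans (le_max_right _ _) hK₀)⟩⟩

/-- **Non-vacuity**: for `d ≧ 1`, `L ≧ 2`, `ε₀ > 0`, `c ≧ 0`, every `K₀ ≧ 1` and every threshold `e₁ > 0` the restricted family has a member meeting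
`regular`, `bigBlocks` and `0 < e ≦ e₁` (p322075's witness: `M = 2K₀`, `K = K_P = 1`, `ε = ε₀/L`, `A = 0`, `e_K = e₁`).
[cite: Balaban1982Higgs1, Prop. 2.1 p.610, dictionary] -/
theorem regTorusFamB_nonvacuous {d L : ℕ} (hd : 1 ≤ d) (hL : 2 ≤ L) (C : ChargeData N) (a msq : ℝ) {ε₀ : ℝ} (hε₀ : 0 < ε₀)
    {creg : ℝ} (hcreg : 0 ≤ creg) (β : ℝ) {K₀ : ℕ} (hK₀ : 1 ≤ K₀) {e₁ : ℝ} (he₁ : 0 < e₁) :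
    ∃ i : RegTorusIdxB d L ε₀ K₀,
      (regTorusFamB d L C a msq ε₀ creg β K₀ i).regular ∧ (regTorusFamB d L C a msq ε₀ creg β K₀ i).bigBlocks ∧
      0 < (regTorusFamB d L C a msq ε₀ creg β K₀ i).e ∧ (regTorusFamB d L C a msq ε₀ creg β K₀ i).e ≤ e₁ := by
  obtain ⟨i, hreg, hbig, hpos, hle⟩ := regTorusFam_nonvacuous hd hL C a msq hε₀ hcreg β hK₀ he₁
  exact ⟨⟨i, hbig⟩, hreg, hbig, hpos, hle⟩

end Family

end Literature.MathematicalPhysics.QuantumFieldTheory.Balaban1983to89.B1Claim18RegularTorus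

end
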